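import Summits.AtomisticToContinuum.Crystallization.Theses.MinMeanCycleStackingLock

/-!
# Route `MinMeanCycleStackingLock`, item stmt-AtomisticToContinuum-12022 `HaggEnergyPeriodic`

For a `p`-periodic sequence `s` (`0 < p`) and any couplings `J`, the stacking energy density
`haggStackingEnergy J s = liminf_n H_n/n` equals the per-period average `haggEnergy p J s / p`.

Proof ([folklore] periodic averaging): the local energies `e m = haggLocalEnergy J s m` are
`p`-periodic in `m` (`haggLocalEnergy_periodic`), so `H_{n+p} = H_n + H_p`, hence
`H_{qp+r} = q·H_p + H_r`, so `|H_n/n − H_p/p| ≤ (B + |H_p|)/n` with `B = ∑_{r<p} |H_r|`; thus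
`H_n/n → H_p/p`, and the `liminf` of a convergent sequence is its limit. The `Summable J`
hypothesis of the item is not needed (the `tsum` defining `haggLocalEnergy` is `p`-periodic in the
base point whatever its value).
-/

namespace Summit.AtomisticToContinuum.Crystallization.Theorems

open Filter Finset
open scoped Topology

open Literature.MathematicalPhysics.StatisticalMechanics

/-- `H_{n+p}(J,s) = H_n(J,s) + H_p(J,s)` for a `p`-periodic sequence `s`. -/
theorem haggEnergy_add_period {s : ℤ → ℤ} {p : ℕ} (hs : ∀ i, s (i + p) = s i) (J : ℕ → ℝ)
    (n : ℕ) : haggEnergy (n + p) J s = haggEnergy n J s + haggEnergy p J s := by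
  have h : ∑ m ∈ range n, haggLocalEnergy J s ((p + m : ℕ) : ℤ)
      = ∑ m ∈ range n, haggLocalEnergy J s m := by
    refine sum_congr rfl fun m _ => ?_
    rw [Nat.cast_add, add_comm, haggLocalEnergy_periodic hs]
  unfold haggEnergy
  rw [add_comm n p, sum_range_add, h, add_comm]

/-- `H_{qp+r}(J,s) = q·H_p(J,s) + H_r(J,s)` for a `p`-periodic sequence `s`. -/
theorem haggEnergy_mul_add_eq {s : ℤ → ℤ} {p : ℕ} (hs : ∀ i, s (i + p) = s i) (J : ℕ → ℝ)
    (q r : ℕ) : haggEnergy (q * p + r) J s = q * haggEnergy p J s + haggEnergy r J s := by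
  induction q with
  | zero => simp
  | succ q ih =>
    rw [show (q + 1) * p + r = (q * p + r) + p by ring, haggEnergy_add_period hs, ih]
    push_cast
    ring

/-- The key estimate: `|H_{qp+r}/(qp+r) − H_p/p| ≤ (∑_{m<p}|H_m| + |H_p|)/(qp+r)` for `r < p`,
`0 < qp + r`. -/
theorem abs_haggEnergy_div_sub_le {s : ℤ → ℤ} {p : ℕ} (hs : ∀ i, s (i + p) = s i) (J : ℕ → ℝ)
    (hp : 0 < p) {q r : ℕ} (hr : r < p) (hn : 0 < q * p + r) :
    |haggEnergy (q * p + r) J s / ((q * p + r : ℕ) : ℝ) - haggEnergy p J s / p|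
      ≤ ((∑ m ∈ range p, |haggEnergy m J s|) + |haggEnergy p J s|) / ((q * p + r : ℕ) : ℝ) := by
  have hp' : (0 : ℝ) < p := by exact_mod_cast hp
  have hn' : (0 : ℝ) < ((q * p + r : ℕ) : ℝ) := by exact_mod_cast hn
  rw [haggEnergy_mul_add_eq hs J q r]
  have e1 : ((q : ℝ) * haggEnergy p J s + haggEnergy r J s) / ((q * p + r : ℕ) : ℝ)
      - haggEnergy p J s / p
      = (haggEnergy r J s - r * haggEnergy p J s / p) / ((q * p + r : ℕ) : ℝ) := by
    have hp0 : (p : ℝ) ≠ 0 := hp'.ne'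
    have hn0 : ((q * p + r : ℕ) : ℝ) ≠ 0 := hn'.ne'
    push_cast at hn0 ⊢
    field_simp
    ring
  rw [e1, abs_div, Nat.abs_cast]
  gcongr
  have h2 : |haggEnergy r J s| ≤ ∑ m ∈ range p, |haggEnergy m J s| :=
    single_le_sum (f := fun m => |haggEnergy m J s|) (fun i _ => abs_nonneg _) (mem_range.mpr hr)
  have h3 : |(r : ℝ) * haggEnergy p J s / p| ≤ |haggEnergy p J s| := by
    rw [abs_div, abs_mul, Nat.abs_cast, Nat.abs_cast, div_le_iff₀ hp']
    have : (r : ℝ) ≤ p := by exact_mod_cast hr.le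
    nlinarith [abs_nonneg (haggEnergy p J s)]
  exact (abs_sub _ _).trans (add_le_add h2 h3)

/-- `H_n(J,s)/n → H_p(J,s)/p` for a `p`-periodic sequence `s`, `0 < p`. -/
theorem tendsto_haggEnergy_div {s : ℤ → ℤ} {p : ℕ} (hs : ∀ i, s (i + p) = s i) (J : ℕ → ℝ)
    (hp : 0 < p) :
    Tendsto (fun n : ℕ => haggEnergy n J s / n) atTop (𝓝 (haggEnergy p J s / p)) := by
  refine tendsto_sub_nhds_zero_iff.mp (squeeze_zero_norm' ?_
    (tendsto_const_div_atTop_nhds_zero_nat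
      ((∑ m ∈ range p, |haggEnergy m J s|) + |haggEnergy p J s|)))
  filter_upwards [eventually_gt_atTop 0] with n hn
  rw [Real.norm_eq_abs]
  have key := abs_haggEnergy_div_sub_le hs J hp (q := n / p) (r := n % p) (Nat.mod_lt n hp)
    (by rw [Nat.div_add_mod']; exact hn)
  rwa [Nat.div_add_mod'] at key

/-- **Item `stmt-AtomisticToContinuum-12022` (`HaggEnergyPeriodic`, route
`MinMeanCycleStackingLock`)**: for summable `J` and a `p`-periodic sequence `s` (`0 < p`) the
stacking energy density `haggStackingEnergy J s` equals `haggEnergy p J s / p`. [folklore] -/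
theorem haggEnergyPeriodic_proof :
    Summit.AtomisticToContinuum.Crystallization.Theses.MinMeanCycleStackingLock.HaggEnergyPeriodic := by
  unfold Summit.AtomisticToContinuum.Crystallization.Theses.MinMeanCycleStackingLock.HaggEnergyPeriodic
  intro J s p _ hp hs
  unfold haggStackingEnergy
  exact (tendsto_haggEnergy_div hs J hp).liminf_eq

end Summit.AtomisticToContinuum.Crystallization.Theorems
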